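import Summits.QuantumFields.YangMills.Theses.ComplexCouplingChannel
import Summits.QuantumFields.YangMills.Theorems.ComplexCouplingChannelComplexStrongCouplingAnchor
import Literature.MathematicalPhysics.QuantumFieldTheory.WilsonFinTorusPartitionComplex
import Literature.MathematicalPhysics.QuantumLattice.GaugeGroupsProofs
import Literature.Barriers.QuantumFields.DiscreteSubgroupFreezing
import HarnessLib

/-!
# Disproof work file — crux `FreeEnergyWindowChannel` (stmt-QuantumFields-18842, route `ComplexCouplingChannel`)

Seat `refuter-cdisprove-stmt-QuantumFields-18842-0`, cycle 1 (2026-08-17).  Everything below is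
sorry-free unless marked NEAR-MISS.  Findings, indexed:

* §0 `freeEnergyWindowChannel_iff` — the crux is DEFINITIONALLY (`Iff.rfl`) the statement
  `∀ G simple compact Lie, ∀ r, Window r` over the tree's named complex partition function
  `wilsonFinTorusPartitionC r.ρ z P P P P` (`WilsonFinTorusPartitionComplex.lean`); the signature
  elaborates (probe rc 0), no junk operator is live: `Real.log ‖Z‖` is only read where `Z ≠ 0` is
  asserted, the integrand is continuous and bounded on a compact probability space, `G` is forced
  Hausdorff and second countable by the faithful continuous `r.ρ`, and the hypothesis class is
  INHABITED unconditionally in the tree (`SU(n)`, `n ≥ 2`, by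
  `isSimpleCompactGroup_specialUnitaryGroup_holds`; `SO(3)` by `isCompactSimpleLieGroup_SO3`), so a
  refutation, if one existed, would not need a `--negative-modulo` construction.
* §1 DEGENERATE / SOLVED DIRECTIONS (the conclusion is satisfiable, hence not junk-false):
  `windowOn_anchor_disc`, `windowAt_small_coupling` — for `|β| < ρ₀(r)` the conclusion `WindowAt r β ρ`
  holds for every `ρ > 0` with `D = ball 0 ρ₀` (from the PROVED anchor stmt-18843); `windowAt_of_ball`
  — for `ρ > |β|` the channel clause is void (`x := β`), so at such `ρ` the crux is the purely LOCAL
  window at `β`.  All content of the crux is therefore in: `β ≥ β₁` LARGE and `ρ ≤ β` (the channel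
  must reach the strong-coupling disc).
* §2 RIGIDITY any witness must satisfy (necessary conditions, PROVED and LANDED as the negative
  lemma file `Theorems/FreeEnergyWindowChannel/Negative/WitnessRigidity.lean`, p146945 ACCEPTED):
  `norm_Z_le_one` (`‖Z(z;P⁴)‖ ≤ 1` on `0 ≤ Re z`, from `Re tr ρ(U) ≤ N`);
  `neg_le_log_partition_re_add` (`-M ≤ log Z(Re z;P⁴) + P⁴ Re f(z)`: the continued free energy is
  bounded below by the physical finite-volume one at `Re z`); `re_nonneg_of_window` (`Re f ≥ 0` on
  `D ∩ {0 ≤ Re z}`); `re_apply_re_le_re_of_window` (`Re f(Re z) ≤ Re f(z)` when `z, Re z ∈ D`: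
  vertical-fibre minimality on the real axis — the finite-`P` shadow of `‖Z(z)‖ ≤ Z(Re z)`, the
  global form of concavity `f'' = -χ ≤ 0`).  These are met automatically by any SUB-dominant
  continued branch, so they do NOT obstruct detours around complex branch points; they do show the
  upper envelope of the picked line `Sketch` needs cancellations `e^{-P⁴(Re f(x+iy) - Re f(x))}` in
  the oscillatory integral (intrinsic sign problem), i.e. it cannot come from modulus bounds.
* §3 LOAD-BEARING ANALYSIS (defs with status; no cheap counterexample is PROVABLE for any mutation):
  - `WindowAllCouplings` (drop "β ≥ β₁"): believed FALSE for first-order bulk rays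
    ((SO(3),3); (SU(2),2⊕3⊕3); SU(N≥5) fundamental — Bhanot–Creutz 1981, Greensite–Lautrup 1981,
    Lucini–Teper–Wenger 2005): at `β_t` the physical free energy has a kink, so no analytic `f` with
    `Re f = f_phys` on both sides.  Unprovable today: no rigorous first-order BULK transition is known
    for any continuous gauge group in `d = 4` (nearest rigorous tool: van Enter–Shlosman
    RP/chessboard for peaked actions, CMP 255 (2005) — would at best give a transition for very
    high-dimensional `r`, and still only kills this mutation, not the crux, which allows a detour).
  - `WindowCompact` (drop `IsCompactSimpleLieGroup`): believed FALSE at `G = U(1)`: the Coulomb phase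
    (`β > β_c ≈ 1.01`, Guth 1980 / Fröhlich–Spencer 1982) is massless, and massless lattice fields on
    the symmetric discrete torus carry `κ log P` terms in `log Z` (zero modes + `det*` of the discrete
    torus Laplacian: Chinta–Jorgenson–Karlsson, Nagoya Math. J. 198 (2010), Main Thm), so
    `log Z(P⁴) + P⁴ f` is unbounded in `P`.  CONSEQUENCE FOR PROVERS: the weak-coupling window is a
    MASSIVE-PHASE statement; any proof must use non-abelian-ness in a form that fails for the `U(1)₄`
    Coulomb phase (barrier `AbelianDeconfinementD4` bites THIS crux too, not only 18841).  Connectedness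
    and faithfulness look NOT load-bearing for 18842 alone (finite groups are massive at large β with
    `e^{-cβP²}` flux-sector corrections; a non-faithful `r` is a faithful rep of `G/ker r`).
  - `WindowUniform` (strengthening: ONE channel/`M` for all `β ≥ β₁`): believed FALSE — at fixed `P`
    the toron zero-modes give `log Z(β;P⁴) + P⁴ f(β) ∼ κ' log β`; so `M = M(β)` necessarily grows.
  - Fixed-`P` information is VOID: each `Z(·;P⁴)` is entire of exponential type with (generically)
    infinitely many isolated zeros, but `∃ P₀` and `∃ D` (open, chosen after `β, ρ`) dodge any finite
    set of them; in particular the finite-temperature ("deconfinement") zeros of the symmetric box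
    near `β_c(N_t = P) → ∞` leave every fixed disc around `β` as `P → ∞` and are dodged by `P₀(β)`;
    only VOLUME-STABLE accumulation curves of zeros (bulk Stokes lines) constrain `D`, and a kill needs
    their global topology to DISCONNECT `0` from `[β₁, ∞)` — unknown even numerically (census §Negation).
* WHY IT RESISTS (cycle 1): the only rigorously controlled regime (`|z| < ρ₀`, cluster expansion) is
  where the conclusion HOLDS (§1); every failure mechanism (first-order rays, massless phases,
  disconnecting zero loci) needs weak/intermediate-coupling control of 4D non-abelian lattice gauge
  theory uniformly in the volume — open-problem grade in print as well (no theorem either way; no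
  non-abelian Lee–Yang theorem: census S⁺(c)).  No kit job was run: the designed falsifier
  (density-of-states Fisher-zero topology of SO(3) / SU(2) F⊕A⊕A tori 4⁴–8⁴) is evidence-grade only and
  cannot produce `¬ FreeEnergyWindowChannel`.
* `-- Targets`: none this cycle (payload.targets = [], no line in payload).
* LINE `Sketch` (lead's PICKED line, read at the boundary; not in this seat's payload): stubs S2–S4 pass the
  degenerate-case reading (S2: `x ∈ D` excludes `D = ∅`, `ε ≤ B` makes `ε^θ B^{1-θ}` antitone in `θ`; S4:
  thickened path; S3: TRUE as typed even though its anchor hypothesis is modulus-only — normalise phases: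
  `g_P := Z_P e^{P⁴ f} e^{iα_P}` is bounded by `e^M` on `D` (envelope), `|g_P| → 1` uniformly on a ball at `x`
  (pinning + anchor force `Re f = Re f_A` there), so by MONTEL (tree: `Complex.exists_strictMono_
  tendstoLocallyUniformlyOn_of_norm_le`, proved) every subsequential limit is holomorphic of modulus `1` on an
  open set, hence a unimodular constant on connected `D` (open mapping + identity theorem) ⇒ `|g_P| → 1`
  locally uniformly ⇒ window with constant `1` on compacts.  So S3 does not need the disc-chain
  hypothesis and S2 is AVOIDABLE; all weight is on S1 = C⁺, which is crux-equivalent given the anchor, and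
  to which §2–§3 below apply verbatim (in particular `re_apply_re_le_re_of_window`: the envelope needs
  cancellations `e^{-P⁴(Re f(x+iy)-Re f(x))}`, it cannot come from modulus bounds `‖Z(z)‖ ≤ Z(Re z)`).
-/

set_option autoImplicit false

noncomputable section

open scoped Topology
open MeasureTheory Filter Set Metric
open Literature.MathematicalPhysics.QuantumFieldTheory Literature.MathematicalPhysics.QuantumLattice
open Summit.QuantumFields.YangMills.Theses.ComplexCouplingChannel

namespace Summit.QuantumFields.YangMills.Cruxes.FreeEnergyWindowChannel.Disproof

variable {G : Type} [Group G] [TopologicalSpace G] [IsTopologicalGroup G] [CompactSpace G]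
  [MeasurableSpace G] [BorelSpace G]

/-! ## §0 The crux in named form -/

/-- The window data on a domain `D`: one analytic `f` and one constant `M` with
`Z(z;P⁴) ≠ 0` and `|log ‖Z(z;P⁴)‖ + P⁴ Re f(z)| ≤ M` for all `P ≥ P₀`, `z ∈ D`
(`Z = wilsonFinTorusPartitionC r.ρ`, the crux's inline `Zc` by `rfl`). -/
def WindowOn (r : LatticeRep G) (D : Set ℂ) : Prop :=
  ∃ f : ℂ → ℂ, DifferentiableOn ℂ f D ∧ ∃ M : ℝ, ∃ P₀ : ℕ, ∀ P : ℕ, P₀ ≤ P → ∀ z ∈ D,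
    wilsonFinTorusPartitionC r.ρ z P P P P ≠ 0 ∧
      |Real.log ‖wilsonFinTorusPartitionC r.ρ z P P P P‖ + (P : ℝ) ^ 4 * (f z).re| ≤ M

/-- The crux's conclusion at target coupling `β` and anchor radius `ρ`: an open connected channel
`D ∋ β` meeting the real interval `(-ρ, ρ)`, carrying window data. -/
def WindowAt (r : LatticeRep G) (β ρ : ℝ) : Prop :=
  ∃ D : Set ℂ, IsOpen D ∧ IsConnected D ∧ (β : ℂ) ∈ D ∧ (∃ x : ℝ, |x| < ρ ∧ (x : ℂ) ∈ D) ∧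
    WindowOn r D

/-- The crux's body for one `(G, r)`. -/
def Window (r : LatticeRep G) : Prop :=
  ∃ β₁ : ℝ, ∀ β : ℝ, β₁ ≤ β → ∀ ρ : ℝ, 0 < ρ → WindowAt r β ρ

/-- **The crux, unboxed** (definitional): `FreeEnergyWindowChannel` is `Window r` for every compact
simple Lie `G` and every faithful unitary `r`. -/
theorem freeEnergyWindowChannel_iff :
    FreeEnergyWindowChannel ↔ ∀ (G : Type) [Group G] [TopologicalSpace G] [IsTopologicalGroup G]
      [CompactSpace G] [MeasurableSpace G] [BorelSpace G], IsCompactSimpleLieGroup G →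
      ∀ r : LatticeRep G, Window r :=
  Iff.rfl

/-- The hypothesis class of the crux is inhabited unconditionally in the tree: `SU(2)`. -/
example : IsCompactSimpleLieGroup (Matrix.specialUnitaryGroup (Fin 2) ℂ) :=
  isCompactSimpleLieGroup_specialUnitaryGroup isSimpleCompactGroup_specialUnitaryGroup_holds le_rfl

/-! ## §1 Degenerate and solved directions -/

/-- Shrinking the domain keeps the window. -/
theorem WindowOn.mono {r : LatticeRep G} {D D' : Set ℂ} (h : WindowOn r D) (hD : D' ⊆ D) :
    WindowOn r D' := by
  obtain ⟨f, hf, M, P₀, h⟩ := h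
  exact ⟨f, hf.mono hD, M, P₀, fun P hP z hz => h P hP z (hD hz)⟩

/-- **The channel clause is void when `ρ > |β|`**: a local window on a disc around `β` already gives
`WindowAt r β ρ` (take `x := β`).  So at such `ρ` the crux is the purely local statement
"the finite-size free energy of the symmetric torus has a bounded analytic continuation near `β`". -/
theorem windowAt_of_ball {r : LatticeRep G} {β ρ ε : ℝ} (hβ : |β| < ρ) (hε : 0 < ε)
    (h : WindowOn r (ball (β : ℂ) ε)) : WindowAt r β ρ :=
  ⟨ball (β : ℂ) ε, isOpen_ball, (convex_ball _ _).isConnected ⟨(β : ℂ), mem_ball_self hε⟩,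
    mem_ball_self hε, ⟨β, hβ, mem_ball_self hε⟩, h⟩

/-- `P⁴ e^{-cP} ≤ (4/c)⁴` for `P ≥ 0`, `c > 0`. [folklore] -/
theorem pow_four_mul_exp_neg_le {c : ℝ} (hc : 0 < c) {P : ℝ} (hP : 0 ≤ P) :
    P ^ 4 * Real.exp (-(c * P)) ≤ (4 / c) ^ 4 := by
  have hy : ∀ y : ℝ, y * Real.exp (-y) ≤ 1 := fun y => by
    have h1 : y ≤ Real.exp y := by linarith [Real.add_one_le_exp y]
    calc y * Real.exp (-y) ≤ Real.exp y * Real.exp (-y) :=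
          mul_le_mul_of_nonneg_right h1 (Real.exp_pos _).le
      _ = 1 := by rw [← Real.exp_add]; simp
  have key : P * Real.exp (-(c * P / 4)) ≤ 4 / c := by
    have hc0 : c ≠ 0 := hc.ne'
    calc P * Real.exp (-(c * P / 4)) = (4 / c) * ((c * P / 4) * Real.exp (-(c * P / 4))) := by
          rw [div_mul_eq_mul_div, eq_div_iff hc0]; ring
      _ ≤ (4 / c) * 1 := mul_le_mul_of_nonneg_left (hy _) (by positivity)
      _ = 4 / c := mul_one _
  have hexp : Real.exp (-(c * P)) = (Real.exp (-(c * P / 4))) ^ 4 := by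
    rw [← Real.exp_nat_mul]; congr 1; push_cast; ring
  calc P ^ 4 * Real.exp (-(c * P)) = (P * Real.exp (-(c * P / 4))) ^ 4 := by rw [hexp, mul_pow]
    _ ≤ (4 / c) ^ 4 := by gcongr

/-- **The window holds on the strong-coupling disc** (from the PROVED anchor stmt-QuantumFields-18843,
`complexStrongCouplingAnchor_proof`): `WindowOn r (ball 0 ρ₀)` with `P₀ = 1` and
`M = max C 0 · (4/c)⁴`.  Simplicity of `G` is carried only because the anchor's statement carries it. -/
theorem windowOn_anchor_disc (hG : IsCompactSimpleLieGroup G) (r : LatticeRep G) :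
    ∃ ρ₀ : ℝ, 0 < ρ₀ ∧ WindowOn r (ball (0 : ℂ) ρ₀) := by
  obtain ⟨ρ₀, hρ₀, c, hc, -, f, hf, C, hC⟩ :=
    Summit.QuantumFields.YangMills.Theorems.complexStrongCouplingAnchor_proof G hG r
  refine ⟨ρ₀, hρ₀, f, hf, max C 0 * (4 / c) ^ 4, 1, fun P hP z hz => ?_⟩
  have hz' : ‖z‖ < ρ₀ := by simpa using hz
  obtain ⟨hne, hb⟩ := hC P hP z hz'
  refine ⟨hne, hb.trans ?_⟩
  have hX : 0 ≤ (P : ℝ) ^ 4 * Real.exp (-(c * P)) := by positivity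
  calc C * (P : ℝ) ^ 4 * Real.exp (-(c * P)) = C * ((P : ℝ) ^ 4 * Real.exp (-(c * P))) := by ring
    _ ≤ max C 0 * ((P : ℝ) ^ 4 * Real.exp (-(c * P))) :=
        mul_le_mul_of_nonneg_right (le_max_left C 0) hX
    _ ≤ max C 0 * (4 / c) ^ 4 :=
        mul_le_mul_of_nonneg_left (pow_four_mul_exp_neg_le hc (Nat.cast_nonneg P)) (le_max_right C 0)

/-- **Small-coupling instance of the crux's conclusion**: for `|β| < ρ₀(r)` and EVERY `ρ > 0`,
`WindowAt r β ρ` (channel `D = ball 0 ρ₀`, `x = 0`).  Hence the crux's content is exactly the passage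
from `|β| < ρ₀` to ARBITRARILY LARGE `β` (with `ρ ≤ β`, cf. `windowAt_of_ball`). -/
theorem windowAt_small_coupling (hG : IsCompactSimpleLieGroup G) (r : LatticeRep G) :
    ∃ ρ₀ : ℝ, 0 < ρ₀ ∧ ∀ β : ℝ, |β| < ρ₀ → ∀ ρ : ℝ, 0 < ρ → WindowAt r β ρ := by
  obtain ⟨ρ₀, hρ₀, hW⟩ := windowOn_anchor_disc hG r
  refine ⟨ρ₀, hρ₀, fun β hβ ρ hρ => ⟨ball (0 : ℂ) ρ₀, isOpen_ball,
    (convex_ball _ _).isConnected ⟨0, mem_ball_self hρ₀⟩, ?_, ⟨0, by simpa using hρ, ?_⟩, hW⟩⟩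
  · rw [mem_ball_zero_iff, Complex.norm_real, Real.norm_eq_abs]; exact hβ
  · rw [Complex.ofReal_zero]; exact mem_ball_self hρ₀

/-! ## §2 Rigidity: necessary conditions on any witness

LANDED (p146945 ACCEPTED, commit e8c7f63e429a) as the tree module
`Summits.QuantumFields.YangMills.Theorems.FreeEnergyWindowChannel.Negative.WitnessRigidity`
(namespace `Summit.QuantumFields.YangMills.Theorems.FreeEnergyWindowChannel.Negative`:
`finTorusWilsonAction_nonneg`, `wilsonFinTorusPartition_le_one`, `norm_wilsonFinTorusPartitionC_le_one`,
`nonpos_of_forall_pow_four_mul_le`, `neg_le_log_partition_re_add`, `re_nonneg_of_window`,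
`re_apply_re_le_re_of_window`).  Import that module in scratch checks; the copies below keep this work
file self-contained (the farm had not rebuilt the new module when v2 was published). -/

omit [MeasurableSpace G] [BorelSpace G] [IsTopologicalGroup G] [CompactSpace G] in
/-- The Wilson action is non-negative for a unitary representation (`Re tr ρ(U) ≤ N`). -/
theorem finTorusWilsonAction_nonneg (r : LatticeRep G) {n₀ n₁ n₂ n₃ : ℕ}
    (U : FinTorusSite n₀ n₁ n₂ n₃ × Fin 4 → G) : 0 ≤ finTorusWilsonAction r.ρ U :=
  Finset.sum_nonneg fun _ _ => Finset.sum_nonneg fun _ _ =>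
    sub_nonneg.2 (Literature.Barriers.QuantumFields.re_trace_le_of_mem_unitaryGroup (r.mem_unitary _))

/-- `Z(β) ≤ 1` for `β ≥ 0` (integral of `e^{-βS} ≤ 1` against a probability measure). -/
theorem wilsonFinTorusPartition_le_one (r : LatticeRep G) {β : ℝ} (hβ : 0 ≤ β) (n₀ n₁ n₂ n₃ : ℕ) :
    wilsonFinTorusPartition r.ρ β n₀ n₁ n₂ n₃ ≤ 1 := by
  unfold wilsonFinTorusPartition
  have key : ∀ g : (FinTorusSite n₀ n₁ n₂ n₃ × Fin 4 → G) → ℝ, (∀ U, g U ≤ 1) →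
      ∫ U, g U ∂(Measure.pi fun _ : FinTorusSite n₀ n₁ n₂ n₃ × Fin 4 => haarProbability G) ≤ 1 := by
    intro g hg
    by_cases hint : Integrable g (Measure.pi fun _ : FinTorusSite n₀ n₁ n₂ n₃ × Fin 4 => haarProbability G)
    · calc ∫ U, g U ∂(Measure.pi fun _ : FinTorusSite n₀ n₁ n₂ n₃ × Fin 4 => haarProbability G)
          ≤ ∫ _U, (1 : ℝ) ∂(Measure.pi fun _ : FinTorusSite n₀ n₁ n₂ n₃ × Fin 4 => haarProbability G) :=
            integral_mono hint (integrable_const 1) hg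
        _ = 1 := by simp
    · rw [integral_undef hint]; exact zero_le_one
  refine key _ fun U => Real.exp_le_one_iff.2 ?_
  have hS : 0 ≤ ∑ x : FinTorusSite n₀ n₁ n₂ n₃, ∑ q : {q : Fin 4 × Fin 4 // q.1 < q.2},
      ((r.N : ℝ) - (r.ρ (finTorusPlaquette U x q.1.1 q.1.2)).trace.re) :=
    finTorusWilsonAction_nonneg r U
  exact mul_nonpos_of_nonpos_of_nonneg (neg_nonpos.2 hβ) hS

/-- **`‖Z(z; P⁴)‖ ≤ 1` on the closed right half-plane** (`‖Z(z)‖ ≤ Z(Re z) ≤ 1`). -/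
theorem norm_Z_le_one (r : LatticeRep G) {z : ℂ} (hz : 0 ≤ z.re) (P : ℕ) :
    ‖wilsonFinTorusPartitionC r.ρ z P P P P‖ ≤ 1 :=
  (norm_wilsonFinTorusPartitionC_le r.ρ z P P P P).trans (wilsonFinTorusPartition_le_one r hz _ _ _ _)

/-- Archimedean step: `P⁴ a ≤ K` for all large `P` forces `a ≤ 0`. -/
theorem nonpos_of_forall_pow_four_mul_le {a K : ℝ} {P₀ : ℕ}
    (h : ∀ P : ℕ, P₀ ≤ P → (P : ℝ) ^ 4 * a ≤ K) : a ≤ 0 := by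
  by_contra ha
  have hpos : 0 < a := lt_of_not_ge ha
  obtain ⟨P, hP⟩ := exists_nat_gt (max (P₀ : ℝ) (K / a))
  have hP₀' : (P₀ : ℝ) < P := (le_max_left _ _).trans_lt hP
  have hP₀ : P₀ ≤ P := by exact_mod_cast hP₀'.le
  have hPK : K / a < P := (le_max_right _ _).trans_lt hP
  have hP1 : (1 : ℝ) ≤ P := by
    have h0 : (0 : ℝ) < P := (Nat.cast_nonneg P₀).trans_lt hP₀'
    exact_mod_cast Nat.one_le_iff_ne_zero.2 (by rintro rfl; simp at h0)
  have hP4 : (P : ℝ) ≤ (P : ℝ) ^ 4 := le_self_pow₀ hP1 (by norm_num)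
  have h3 : K < (P : ℝ) * a := by rwa [div_lt_iff₀ hpos] at hPK
  have h4 := h P hP₀
  nlinarith [mul_le_mul_of_nonneg_right hP4 hpos.le]

/-- **Lower rigidity**: window data on `D` ⇒ `-M ≤ log Z(Re z;P⁴) + P⁴ Re f(z)` for all `P ≥ P₀`, `z ∈ D`
(`-M ≤ log ‖Z(z)‖ + P⁴ Re f(z)` and `‖Z(z)‖ ≤ Z(Re z)`): in the limit `Re f(z) ≥ f_phys(Re z)` — the continued
branch is never super-dominant w.r.t. the physical free energy at the same `Re z`. -/
theorem neg_le_log_partition_re_add (r : LatticeRep G) {D : Set ℂ} {f : ℂ → ℂ} {M : ℝ} {P₀ : ℕ}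
    (h : ∀ P : ℕ, P₀ ≤ P → ∀ z ∈ D, wilsonFinTorusPartitionC r.ρ z P P P P ≠ 0 ∧
      |Real.log ‖wilsonFinTorusPartitionC r.ρ z P P P P‖ + (P : ℝ) ^ 4 * (f z).re| ≤ M)
    {P : ℕ} (hP : P₀ ≤ P) {z : ℂ} (hz : z ∈ D) :
    -M ≤ Real.log (wilsonFinTorusPartition r.ρ z.re P P P P) + (P : ℝ) ^ 4 * (f z).re := by
  obtain ⟨hne, hb⟩ := h P hP z hz
  have h1 := (abs_le.1 hb).1
  have hlog : Real.log ‖wilsonFinTorusPartitionC r.ρ z P P P P‖ ≤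
      Real.log (wilsonFinTorusPartition r.ρ z.re P P P P) :=
    Real.log_le_log (norm_pos_iff.2 hne) (norm_wilsonFinTorusPartitionC_le r.ρ z P P P P)
  linarith

/-- **`Re f ≥ 0` on the right half-plane part of the channel**: window data on `D` force `0 ≤ Re f(z)` at
every `z ∈ D` with `0 ≤ Re z`. -/
theorem re_nonneg_of_window (r : LatticeRep G) {D : Set ℂ} {f : ℂ → ℂ} {M : ℝ} {P₀ : ℕ}
    (h : ∀ P : ℕ, P₀ ≤ P → ∀ z ∈ D, wilsonFinTorusPartitionC r.ρ z P P P P ≠ 0 ∧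
      |Real.log ‖wilsonFinTorusPartitionC r.ρ z P P P P‖ + (P : ℝ) ^ 4 * (f z).re| ≤ M)
    {z : ℂ} (hz : z ∈ D) (hz0 : 0 ≤ z.re) : 0 ≤ (f z).re := by
  have key : ∀ P : ℕ, P₀ ≤ P → (P : ℝ) ^ 4 * (-(f z).re) ≤ M := fun P hP => by
    have h1 := neg_le_log_partition_re_add r h hP hz
    have hlog : Real.log (wilsonFinTorusPartition r.ρ z.re P P P P) ≤ 0 :=
      Real.log_nonpos ((norm_nonneg _).trans (norm_wilsonFinTorusPartitionC_le r.ρ z P P P P))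
        (wilsonFinTorusPartition_le_one r hz0 _ _ _ _)
    linarith
  have := nonpos_of_forall_pow_four_mul_le key
  linarith

/-- **Vertical-fibre minimality**: window data on `D` and `z, Re z ∈ D` ⇒ `Re f(Re z) ≤ Re f(z)` — on each
vertical fibre of a channel the real part of the continued bulk free energy is minimal on the real axis (the
finite-`P` shadow of `‖Z(z)‖ ≤ Z(Re z)`, global form of the concavity `f'' = -χ ≤ 0`).  So a witness `f` is never
locally `c + (z-β)²`-like at a real `β ∈ D`, and the upper envelope of line `Sketch` at `x+iy` requires
cancellations of size `e^{-P⁴(Re f(x+iy) - Re f(x))}` in the oscillatory integral `Z_P(x+iy)`. -/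
theorem re_apply_re_le_re_of_window (r : LatticeRep G) {D : Set ℂ} {f : ℂ → ℂ} {M : ℝ} {P₀ : ℕ}
    (h : ∀ P : ℕ, P₀ ≤ P → ∀ z ∈ D, wilsonFinTorusPartitionC r.ρ z P P P P ≠ 0 ∧
      |Real.log ‖wilsonFinTorusPartitionC r.ρ z P P P P‖ + (P : ℝ) ^ 4 * (f z).re| ≤ M)
    {z : ℂ} (hz : z ∈ D) (hzr : ((z.re : ℝ) : ℂ) ∈ D) :
    (f (z.re : ℂ)).re ≤ (f z).re := by
  haveI : SecondCountableTopology G :=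
    (r.continuous.isClosedEmbedding r.injective).isEmbedding.secondCountableTopology
  have key : ∀ P : ℕ, P₀ ≤ P → (P : ℝ) ^ 4 * ((f (z.re : ℂ)).re - (f z).re) ≤ 2 * M := fun P hP => by
    have h1 := neg_le_log_partition_re_add r h hP hz
    obtain ⟨-, hb⟩ := h P hP _ hzr
    have h2 := (abs_le.1 hb).2
    have hnorm : ‖wilsonFinTorusPartitionC r.ρ ((z.re : ℝ) : ℂ) P P P P‖ =
        wilsonFinTorusPartition r.ρ z.re P P P P := by
      rw [wilsonFinTorusPartitionC_ofReal, Complex.norm_real, Real.norm_eq_abs,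
        abs_of_pos (wilsonFinTorusPartition_pos r.continuous z.re P P P P)]
    rw [hnorm] at h2
    linarith
  have := nonpos_of_forall_pow_four_mul_le key
  linarith

/-! ## §3 Load-bearing analysis: the mutations (status in the module docstring) -/

/-- MUTATION "drop `β ≥ β₁`": the window at EVERY non-negative coupling.  Believed false on first-order
bulk rays ((SO(3),3), (SU(2),2⊕3⊕3), SU(N≥5) fundamental); not provable with present tools (no
rigorous first-order bulk transition for a continuous gauge group in `d = 4`). -/
def WindowAllCouplings (r : LatticeRep G) : Prop :=
  ∀ β : ℝ, 0 ≤ β → ∀ ρ : ℝ, 0 < ρ → WindowAt r β ρ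

/-- The crux's `Window r` is the large-`β` tail of `WindowAllCouplings r` (trivial direction). -/
theorem window_of_windowAllCouplings {r : LatticeRep G} (h : WindowAllCouplings r) : Window r :=
  ⟨0, fun β hβ ρ hρ => h β hβ ρ hρ⟩

/-- MUTATION "drop `IsCompactSimpleLieGroup`": the window for EVERY compact group with a faithful
unitary representation.  Believed false at `G = U(1)` (Coulomb phase is massless ⇒ `κ log P` growth of
`log Z(P⁴) + P⁴ f`; Guth 1980, Fröhlich–Spencer 1982, Chinta–Jorgenson–Karlsson 2010); unprovable here.
Connectedness / faithfulness alone look NOT load-bearing for this crux. -/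
def WindowCompact : Prop :=
  ∀ (G : Type) [Group G] [TopologicalSpace G] [IsTopologicalGroup G] [CompactSpace G]
    [MeasurableSpace G] [BorelSpace G], ∀ r : LatticeRep G, Window r

/-- `WindowCompact` trivially implies the crux (it drops a hypothesis). -/
theorem freeEnergyWindowChannel_of_windowCompact (h : WindowCompact) : FreeEnergyWindowChannel :=
  freeEnergyWindowChannel_iff.2 fun G _ _ _ _ _ _ _ r => h G r

/-- STRENGTHENING "one channel for all large `β`": a single `D ⊇ [β₁, ∞)`, one `f`, one `M`.  Believed
false (toron zero modes: `M(β) ≳ κ' log β` at fixed `P`); so in the crux `M`, `D`, `P₀` genuinely depend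
on `β`. -/
def WindowUniform (r : LatticeRep G) : Prop :=
  ∃ β₁ : ℝ, ∃ D : Set ℂ, IsOpen D ∧ IsConnected D ∧ (∀ β : ℝ, β₁ ≤ β → (β : ℂ) ∈ D) ∧
    (∀ ρ : ℝ, 0 < ρ → ∃ x : ℝ, |x| < ρ ∧ (x : ℂ) ∈ D) ∧ WindowOn r D

/-- `WindowUniform r → Window r` (trivial direction; the converse is the believed-false one). -/
theorem window_of_windowUniform {r : LatticeRep G} (h : WindowUniform r) : Window r := by
  obtain ⟨β₁, D, hD, hDc, hβ, hx, hW⟩ := h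
  exact ⟨β₁, fun β hb ρ hρ => ⟨D, hD, hDc, hβ β hb, hx ρ hρ, hW⟩⟩

-- Targets: none (payload.targets = []; no line picked in this seat's payload).

end Summit.QuantumFields.YangMills.Cruxes.FreeEnergyWindowChannel.Disproof

end
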